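import Literature.NumberTheory.LFunctions.WeilPositivityMinorant
import Mathlib.Analysis.SumIntegralComparisons
import HarnessLib

/-!
# Integral-test tails for the vertical digamma series

Topic: `Literature/NumberTheory/LFunctions` (certified numerics for the archimedean Weil weight
`w(t) = Re ψ(1/4 + it/2) = ψ(1/4) + Σ_m f_{l_m}(t)`, `f_l(t) = 2t²/(l(l² + t²))`, `l_m = 2m + 1/2`;
`Literature.Analysis.SpecialFunctions.DigammaVerticalSeries`).

The certified lower bounds of `WeilPositivityMinorant.lean` drop the tail `m ≥ M` of the series of
increments and bound the tail of the series itself by a telescoping sum; both lose `O(t²/l_M³)` with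
constants that force `M` in the thousands at accuracy `10⁻⁹`. Here the tails are bounded below by the
INTEGRAL TEST (the terms are decreasing in `m`, and both integrands have elementary primitives):

* `sum_digammaTerm_add_logTail_le` —
  `ψ(1/4) + Σ_{m<M} f_{l_m}(t) + ½ log(1 + t²/l_M²) ≤ Re ψ(1/4 + it/2)`;
* `reDigammaQuarter_sub_ge_sum_add_tail` — for `0 ≤ u ≤ t ≤ v ≤ l_M` and termwise lower bounds
  `b_m` of the increments, `Σ_{m<M} b_m + (t² − u²)/(2(l_M² + v²)) ≤ Re ψ(1/4+it/2) − Re ψ(1/4+iu/2)`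
  (`Σ_{m≥M} 2l_m/((l_m²+u²)(l_m²+v²)) ≥ (1/(2(v²−u²))) log(1 + (v²−u²)/(l_M²+u²)) ≥ 1/(2(l_M²+v²))`),
  with the linear and polynomial cell forms `…_lin_add_tail`, `…_poly_add_tail`;
* the rational forms `wTailLoQ₂`, `wLoQ₂` (`wLoQ₂_le`) and `linTailLoQ` (`linTailLoQ_le`) used by
  certificate checkers.

Everything here is proved; no named facts.

## References

* H. Yoshida, *On Hermitian forms attached to zeta functions*, Adv. Stud. Pure Math. 21 (1992), §6
  (the series and its certified truncations). [Yoshida1992]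
-/

noncomputable section

open Real Set Filter MeasureTheory intervalIntegral
open scoped Topology BigOperators

namespace Literature.NumberTheory.LFunctions

open Literature.Analysis.SpecialFunctions

/-! ## The tail of the series `Σ_m f_{l_m}(t)` -/

/-- A primitive of `x ↦ f_{2x+1/2}(t)`: `log(2x + 1/2) − ½ log((2x + 1/2)² + t²)`. [folklore] -/
def digammaTermPrim (t x : ℝ) : ℝ :=
  Real.log (2 * x + 1 / 2) - 1 / 2 * Real.log ((2 * x + 1 / 2) ^ 2 + t ^ 2)

/-- `d/dx [log(2x+1/2) − ½ log((2x+1/2)² + t²)] = f_{2x+1/2}(t)` for `2x + 1/2 > 0`. [folklore] -/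
lemma hasDerivAt_digammaTermPrim (t : ℝ) {x : ℝ} (hx : 0 < 2 * x + 1 / 2) :
    HasDerivAt (digammaTermPrim t) (digammaTerm (2 * x + 1 / 2) t) x := by
  have hl : HasDerivAt (fun y : ℝ ↦ 2 * y + 1 / 2) 2 x := by
    simpa using ((hasDerivAt_id x).const_mul (2 : ℝ)).add_const (1 / 2 : ℝ)
  have h1 : HasDerivAt (fun y : ℝ ↦ Real.log (2 * y + 1 / 2)) (2 / (2 * x + 1 / 2)) x :=
    hl.log hx.ne'
  have hq : HasDerivAt (fun y : ℝ ↦ (2 * y + 1 / 2) ^ 2 + t ^ 2) (2 * (2 * x + 1 / 2) * 2) x := by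
    have := (hl.pow 2).add_const (t ^ 2)
    simpa using this
  have hpos : 0 < (2 * x + 1 / 2) ^ 2 + t ^ 2 := by positivity
  have h2 : HasDerivAt (fun y : ℝ ↦ 1 / 2 * Real.log ((2 * y + 1 / 2) ^ 2 + t ^ 2))
      (1 / 2 * (2 * (2 * x + 1 / 2) * 2 / ((2 * x + 1 / 2) ^ 2 + t ^ 2))) x :=
    (hq.log hpos.ne').const_mul (1 / 2)
  have h := h1.sub h2
  have e : 2 / (2 * x + 1 / 2) - 1 / 2 * (2 * (2 * x + 1 / 2) * 2 / ((2 * x + 1 / 2) ^ 2 + t ^ 2)) =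
      digammaTerm (2 * x + 1 / 2) t := by
    rw [digammaTerm_eq hx]; ring
  rw [← e]
  exact h

/-- `x ↦ f_{2x+1/2}(t)` is continuous on `[0, ∞)` (indeed on `x > −1/4`). [folklore] -/
lemma continuousOn_digammaTerm_affine (t : ℝ) :
    ContinuousOn (fun x : ℝ ↦ digammaTerm (2 * x + 1 / 2) t) (Ici 0) := by
  unfold digammaTerm
  refine ContinuousOn.div (by fun_prop) (by fun_prop) fun x hx ↦ ?_
  have hx' : (0 : ℝ) ≤ x := hx
  positivity

/-- `x ↦ f_{2x+1/2}(t)` is decreasing on `[0, ∞)`. [folklore] -/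
lemma digammaTerm_affine_antitone (t : ℝ) {x y : ℝ} (hx : 0 ≤ x) (hxy : x ≤ y) :
    digammaTerm (2 * y + 1 / 2) t ≤ digammaTerm (2 * x + 1 / 2) t := by
  unfold digammaTerm
  have h0 : 0 < 2 * x + 1 / 2 := by linarith
  refine div_le_div_of_nonneg_left (by positivity) (by positivity) ?_
  have h1 : 2 * x + 1 / 2 ≤ 2 * y + 1 / 2 := by linarith
  exact mul_le_mul h1 (by nlinarith) (by positivity) (by linarith)

/-- `∫_M^{M+K} f_{2x+1/2}(t) dx = F(M+K) − F(M)`. [folklore] -/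
lemma integral_digammaTerm_affine (t : ℝ) (M K : ℕ) :
    ∫ x in (M : ℝ)..(M : ℝ) + K, digammaTerm (2 * x + 1 / 2) t =
      digammaTermPrim t ((M : ℝ) + K) - digammaTermPrim t M := by
  have hM : (0 : ℝ) ≤ M := Nat.cast_nonneg M
  have hK : (0 : ℝ) ≤ K := Nat.cast_nonneg K
  refine integral_eq_sub_of_hasDerivAt (fun x hx ↦ ?_) ?_
  · have h0 : 0 ≤ x := by
      rw [uIcc_of_le (by linarith)] at hx; exact hM.trans hx.1
    exact hasDerivAt_digammaTermPrim t (by linarith)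
  · refine ((continuousOn_digammaTerm_affine t).mono fun x hx ↦ ?_).intervalIntegrable
    rw [uIcc_of_le (by linarith)] at hx
    exact hM.trans hx.1

/-- `F(x) = −½ log(1 + t²/(2x+1/2)²)` for `2x + 1/2 > 0`. [folklore] -/
lemma digammaTermPrim_eq (t : ℝ) {x : ℝ} (hx : 0 < 2 * x + 1 / 2) :
    digammaTermPrim t x = -(1 / 2) * Real.log (1 + t ^ 2 / (2 * x + 1 / 2) ^ 2) := by
  unfold digammaTermPrim
  have hl2 : 0 < (2 * x + 1 / 2) ^ 2 := by positivity
  have e1 : Real.log (2 * x + 1 / 2) = 1 / 2 * Real.log ((2 * x + 1 / 2) ^ 2) := by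
    rw [Real.log_pow]; push_cast; ring
  have e2 : 1 + t ^ 2 / (2 * x + 1 / 2) ^ 2 = ((2 * x + 1 / 2) ^ 2 + t ^ 2) / (2 * x + 1 / 2) ^ 2 := by
    rw [add_div, div_self hl2.ne']
  rw [e1, e2, Real.log_div (by positivity) hl2.ne']
  ring

/-- `F(M + K) → 0` as `K → ∞`. [folklore] -/
lemma tendsto_digammaTermPrim (t : ℝ) (M : ℕ) :
    Tendsto (fun K : ℕ ↦ digammaTermPrim t ((M : ℝ) + K)) atTop (𝓝 0) := by
  have hM : (0 : ℝ) ≤ M := Nat.cast_nonneg M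
  have hl : Tendsto (fun K : ℕ ↦ (2 * ((M : ℝ) + K) + 1 / 2) ^ 2) atTop atTop := by
    refine (tendsto_pow_atTop two_ne_zero).comp ?_
    refine tendsto_atTop_add_const_right _ _ (Tendsto.const_mul_atTop two_pos ?_)
    exact tendsto_atTop_add_const_left _ _ tendsto_natCast_atTop_atTop
  have h1 : Tendsto (fun K : ℕ ↦ t ^ 2 / (2 * ((M : ℝ) + K) + 1 / 2) ^ 2) atTop (𝓝 0) :=
    tendsto_const_nhds.div_atTop hl
  have h2 : Tendsto (fun K : ℕ ↦ Real.log (1 + t ^ 2 / (2 * ((M : ℝ) + K) + 1 / 2) ^ 2)) atTop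
      (𝓝 (Real.log (1 + 0))) :=
    (Real.continuousAt_log (by norm_num)).tendsto.comp (tendsto_const_nhds.add h1)
  rw [add_zero, Real.log_one] at h2
  have h3 := h2.const_mul (-(1 / 2) : ℝ)
  rw [mul_zero] at h3
  refine h3.congr fun K ↦ ?_
  rw [digammaTermPrim_eq t (by positivity)]

/-- **Integral-test tail bound for the vertical series.**
`ψ(1/4) + Σ_{m<M} f_{l_m}(t) + ½ log(1 + t²/l_M²) ≤ Re ψ(1/4 + it/2)`
(`Σ_{m≥M} f_{l_m}(t) ≥ ∫_M^∞ f_{2x+1/2}(t) dx = ½ log(1 + t²/l_M²)`, the terms being decreasing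
in `m`). [cite: Yoshida1992, §6 (series); integral test folklore] -/
theorem sum_digammaTerm_add_logTail_le (M : ℕ) (t : ℝ) :
    reDigammaQuarter 0 + ∑ m ∈ Finset.range M, digammaTerm (digammaNode m) t +
        1 / 2 * Real.log (1 + t ^ 2 / digammaNode M ^ 2) ≤
      reDigammaQuarter t := by
  set f : ℕ → ℝ := fun m ↦ digammaTerm (digammaNode m) t with hf
  have hS := (hasSum_nat_add_iff' M).2 (hasSum_digammaTerm t)
  set S := reDigammaQuarter t - reDigammaQuarter 0 - ∑ i ∈ Finset.range M, f i with hSdef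
  have hM : (0 : ℝ) ≤ M := Nat.cast_nonneg M
  -- partial sums of the tail dominate the integrals
  have hpart : ∀ K : ℕ, digammaTermPrim t ((M : ℝ) + K) - digammaTermPrim t M ≤ S := by
    intro K
    have h1 : ∑ i ∈ Finset.range K, f (i + M) ≤ S :=
      sum_le_hasSum (Finset.range K) (fun i _ ↦ digammaTerm_nonneg (digammaNode_pos _) t) hS
    have hanti : AntitoneOn (fun x : ℝ ↦ digammaTerm (2 * x + 1 / 2) t) (Icc (M : ℝ) ((M : ℝ) + K)) :=
      fun x hx y _ hxy ↦ digammaTerm_affine_antitone t (hM.trans hx.1) hxy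
    have h2 := hanti.integral_le_sum
    rw [integral_digammaTerm_affine] at h2
    have h3 : ∑ i ∈ Finset.range K, digammaTerm (2 * ((M : ℝ) + i) + 1 / 2) t =
        ∑ i ∈ Finset.range K, f (i + M) := by
      refine Finset.sum_congr rfl fun i _ ↦ ?_
      rw [hf]
      simp only [digammaNode]
      push_cast
      ring_nf
    linarith
  have hlim : Tendsto (fun K : ℕ ↦ digammaTermPrim t ((M : ℝ) + K) - digammaTermPrim t M) atTop
      (𝓝 (0 - digammaTermPrim t M)) :=
    (tendsto_digammaTermPrim t M).sub tendsto_const_nhds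
  have hle : 0 - digammaTermPrim t M ≤ S := le_of_tendsto' hlim hpart
  have hval : 0 - digammaTermPrim t M = 1 / 2 * Real.log (1 + t ^ 2 / digammaNode M ^ 2) := by
    rw [digammaTermPrim_eq t (by positivity)]
    simp only [digammaNode]
    ring
  rw [hval, hSdef] at hle
  linarith

/-- `x/(2(1 + x))·` form: `t²/(2(l_M² + t²)) ≤ ½ log(1 + t²/l_M²)` (`log y ≥ 1 − 1/y`). [folklore] -/
lemma sq_div_le_half_log (M : ℕ) (t : ℝ) :
    t ^ 2 / (2 * (digammaNode M ^ 2 + t ^ 2)) ≤ 1 / 2 * Real.log (1 + t ^ 2 / digammaNode M ^ 2) := by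
  have hl := digammaNode_pos M
  have hl2 : 0 < digammaNode M ^ 2 := by positivity
  have hy : 0 < 1 + t ^ 2 / digammaNode M ^ 2 := by positivity
  have h := Real.one_sub_inv_le_log_of_pos hy
  have e : 1 - (1 + t ^ 2 / digammaNode M ^ 2)⁻¹ = t ^ 2 / (digammaNode M ^ 2 + t ^ 2) := by
    field_simp
    ring
  rw [e] at h
  have e2 : t ^ 2 / (2 * (digammaNode M ^ 2 + t ^ 2)) = 1 / 2 * (t ^ 2 / (digammaNode M ^ 2 + t ^ 2)) := by
    rw [mul_comm (2 : ℝ) _, ← div_div]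
    ring
  rw [e2]
  linarith

/-- The rational tail term `t²/(2(l_M² + t²))`. [folklore] -/
def wTailLoQ₂ (t : ℚ) (M : ℕ) : ℚ :=
  t * t / (2 * (digammaNodeQ M * digammaNodeQ M + t * t))

/-- Cast of `wTailLoQ₂`. [folklore] -/
theorem wTailLoQ₂_cast (t : ℚ) (M : ℕ) :
    ((wTailLoQ₂ t M : ℚ) : ℝ) = (t : ℝ) ^ 2 / (2 * (digammaNode M ^ 2 + (t : ℝ) ^ 2)) := by
  unfold wTailLoQ₂; push_cast; rw [digammaNodeQ_cast]; ring

/-- **Certified lower bound for `Re ψ(1/4 + it/2)`, integral-test tail:**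
`ψ(1/4)_lo + Σ_{m<M} rd f_{l_m}(t) + rd(t²/(2(l_M² + t²)))`. [folklore] -/
def wLoQ₂ (p : ℕ) (t : ℚ) (M : ℕ) : ℚ :=
  psiQuarterLo + sumR M (fun m ↦ ratRd p (digammaTermQ t m)) + ratRd p (wTailLoQ₂ t M)

/-- **Soundness of `wLoQ₂`**: `wLoQ₂ p t M ≤ Re ψ(1/4 + it/2)`. [folklore] -/
theorem wLoQ₂_le (p : ℕ) (t : ℚ) (M : ℕ) : ((wLoQ₂ p t M : ℚ) : ℝ) ≤ reDigammaQuarter t := by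
  have h := sum_digammaTerm_add_logTail_le M (t : ℝ)
  have h1 : ((sumR M (fun m ↦ ratRd p (digammaTermQ t m)) : ℚ) : ℝ) ≤
      ∑ m ∈ Finset.range M, digammaTerm (digammaNode m) t := by
    rw [sumR_eq_sum]
    push_cast
    refine Finset.sum_le_sum fun m _ ↦ ?_
    rw [← digammaTermQ_cast]
    exact_mod_cast ratRd_le p (digammaTermQ t m)
  have h2 : ((ratRd p (wTailLoQ₂ t M) : ℚ) : ℝ) ≤ 1 / 2 * Real.log (1 + (t : ℝ) ^ 2 / digammaNode M ^ 2) := by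
    refine le_trans ?_ (sq_div_le_half_log M (t : ℝ))
    rw [← wTailLoQ₂_cast]
    exact_mod_cast ratRd_le p (wTailLoQ₂ t M)
  have h3 := psiQuarterLo_le
  unfold wLoQ₂
  push_cast
  linarith

/-! ## The tail of the series of linear increments `Σ_m 2l_m/((l_m² + u²)(l_m² + v²))` -/

/-- The linear-increment term at a real abscissa index `x` (`l = 2x + 1/2`). [folklore] -/
def linG (u v x : ℝ) : ℝ :=
  2 * (2 * x + 1 / 2) / (((2 * x + 1 / 2) ^ 2 + u ^ 2) * ((2 * x + 1 / 2) ^ 2 + v ^ 2))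

/-- A primitive of `linG u v`: `(log(l² + u²) − log(l² + v²))/(2(v² − u²))`. [folklore] -/
def linGPrim (u v x : ℝ) : ℝ :=
  (Real.log ((2 * x + 1 / 2) ^ 2 + u ^ 2) - Real.log ((2 * x + 1 / 2) ^ 2 + v ^ 2)) /
    (2 * (v ^ 2 - u ^ 2))

/-- `d/dx linGPrim = linG` (`u² < v²`). [folklore] -/
lemma hasDerivAt_linGPrim {u v : ℝ} (huv : u ^ 2 < v ^ 2) {x : ℝ} (hx : 0 < 2 * x + 1 / 2) :
    HasDerivAt (linGPrim u v) (linG u v x) x := by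
  have hl : HasDerivAt (fun y : ℝ ↦ 2 * y + 1 / 2) 2 x := by
    simpa using ((hasDerivAt_id x).const_mul (2 : ℝ)).add_const (1 / 2 : ℝ)
  have hqu : HasDerivAt (fun y : ℝ ↦ (2 * y + 1 / 2) ^ 2 + u ^ 2) (2 * (2 * x + 1 / 2) * 2) x := by
    simpa using (hl.pow 2).add_const (u ^ 2)
  have hqv : HasDerivAt (fun y : ℝ ↦ (2 * y + 1 / 2) ^ 2 + v ^ 2) (2 * (2 * x + 1 / 2) * 2) x := by
    simpa using (hl.pow 2).add_const (v ^ 2)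
  have hu0 : 0 < (2 * x + 1 / 2) ^ 2 + u ^ 2 := by positivity
  have hv0 : 0 < (2 * x + 1 / 2) ^ 2 + v ^ 2 := by positivity
  have h := ((hqu.log hu0.ne').sub (hqv.log hv0.ne')).div_const (2 * (v ^ 2 - u ^ 2))
  have hd : v ^ 2 - u ^ 2 ≠ 0 := by linarith
  set l := 2 * x + 1 / 2 with hl_def
  have e : (2 * l * 2 / (l ^ 2 + u ^ 2) - 2 * l * 2 / (l ^ 2 + v ^ 2)) / (2 * (v ^ 2 - u ^ 2)) =
      linG u v x := by
    unfold linG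
    rw [← hl_def, div_sub_div _ _ hu0.ne' hv0.ne', div_div,
      div_eq_div_iff (mul_ne_zero (mul_ne_zero hu0.ne' hv0.ne') (mul_ne_zero two_ne_zero hd))
        (mul_ne_zero hu0.ne' hv0.ne')]
    ring
  rw [← e]
  exact h

/-- `linG u v` is continuous on `[0, ∞)`. [folklore] -/
lemma continuousOn_linG (u v : ℝ) : ContinuousOn (linG u v) (Ici 0) := by
  unfold linG
  refine ContinuousOn.div (by fun_prop) (by fun_prop) fun x hx ↦ ?_
  have hx' : (0 : ℝ) ≤ x := hx
  positivity

/-- `linG u v` is decreasing in `x ≥ 0` once `l = 2x + 1/2 ≥ v ≥ u ≥ 0`. [folklore] -/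
lemma linG_antitone {u v x y : ℝ} (hu : 0 ≤ u) (huv : u ≤ v) (hx0 : 0 ≤ x)
    (hvx : v ≤ 2 * x + 1 / 2) (hxy : x ≤ y) : linG u v y ≤ linG u v x := by
  unfold linG
  set a := 2 * x + 1 / 2 with ha
  set b := 2 * y + 1 / 2 with hb
  have ha0 : 0 < a := by rw [ha]; linarith
  have hab : a ≤ b := by rw [ha, hb]; linarith
  have hb0 : 0 < b := by linarith
  rw [div_le_div_iff₀ (by positivity) (by positivity)]
  have key : 2 * a * ((b ^ 2 + u ^ 2) * (b ^ 2 + v ^ 2)) - 2 * b * ((a ^ 2 + u ^ 2) * (a ^ 2 + v ^ 2)) =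
      2 * (b - a) * (a * b * (a ^ 2 + a * b + b ^ 2) + (u ^ 2 + v ^ 2) * (a * b) - u ^ 2 * v ^ 2) := by
    ring
  have hbr : 0 ≤ a * b * (a ^ 2 + a * b + b ^ 2) + (u ^ 2 + v ^ 2) * (a * b) - u ^ 2 * v ^ 2 := by
    have hv : 0 ≤ v := hu.trans huv
    have h1 : v ^ 2 ≤ a * b := by nlinarith
    have h2 : u ^ 2 * v ^ 2 ≤ (u ^ 2 + v ^ 2) * (a * b) := by nlinarith [sq_nonneg u, sq_nonneg v]
    nlinarith [mul_pos ha0 hb0, sq_nonneg a, sq_nonneg b]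
  nlinarith [mul_nonneg (mul_nonneg (by norm_num : (0 : ℝ) ≤ 2) (sub_nonneg.2 hab)) hbr, key]

/-- `∫_M^{M+K} linG = linGPrim(M+K) − linGPrim(M)`. [folklore] -/
lemma integral_linG {u v : ℝ} (huv : u ^ 2 < v ^ 2) (M K : ℕ) :
    ∫ x in (M : ℝ)..(M : ℝ) + K, linG u v x = linGPrim u v ((M : ℝ) + K) - linGPrim u v M := by
  have hM : (0 : ℝ) ≤ M := Nat.cast_nonneg M
  have hK : (0 : ℝ) ≤ K := Nat.cast_nonneg K
  refine integral_eq_sub_of_hasDerivAt (fun x hx ↦ ?_) ?_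
  · have h0 : 0 ≤ x := by
      rw [uIcc_of_le (by linarith)] at hx; exact hM.trans hx.1
    exact hasDerivAt_linGPrim huv (by linarith)
  · refine ((continuousOn_linG u v).mono fun x hx ↦ ?_).intervalIntegrable
    rw [uIcc_of_le (by linarith)] at hx
    exact hM.trans hx.1

/-- `linGPrim(M + K) → 0` as `K → ∞`. [folklore] -/
lemma tendsto_linGPrim (u v : ℝ) (M : ℕ) :
    Tendsto (fun K : ℕ ↦ linGPrim u v ((M : ℝ) + K)) atTop (𝓝 0) := by
  have hM : (0 : ℝ) ≤ M := Nat.cast_nonneg M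
  have hl : Tendsto (fun K : ℕ ↦ (2 * ((M : ℝ) + K) + 1 / 2) ^ 2) atTop atTop := by
    refine (tendsto_pow_atTop two_ne_zero).comp ?_
    refine tendsto_atTop_add_const_right _ _ (Tendsto.const_mul_atTop two_pos ?_)
    exact tendsto_atTop_add_const_left _ _ tendsto_natCast_atTop_atTop
  -- log(l² + c²) − log l² → 0 for each constant c, hence the difference → 0
  have hlog : ∀ c : ℝ, Tendsto (fun K : ℕ ↦ Real.log ((2 * ((M : ℝ) + K) + 1 / 2) ^ 2 + c ^ 2) -
      Real.log ((2 * ((M : ℝ) + K) + 1 / 2) ^ 2)) atTop (𝓝 0) := by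
    intro c
    have h1 : Tendsto (fun K : ℕ ↦ c ^ 2 / (2 * ((M : ℝ) + K) + 1 / 2) ^ 2) atTop (𝓝 0) :=
      tendsto_const_nhds.div_atTop hl
    have h2 : Tendsto (fun K : ℕ ↦ Real.log (1 + c ^ 2 / (2 * ((M : ℝ) + K) + 1 / 2) ^ 2)) atTop
        (𝓝 (Real.log (1 + 0))) :=
      (Real.continuousAt_log (by norm_num)).tendsto.comp (tendsto_const_nhds.add h1)
    rw [add_zero, Real.log_one] at h2
    refine h2.congr fun K ↦ ?_
    have hp : 0 < (2 * ((M : ℝ) + K) + 1 / 2) ^ 2 := by positivity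
    rw [← Real.log_div (by positivity) hp.ne', add_div, div_self hp.ne']
  have h := ((hlog u).sub (hlog v)).div_const (2 * (v ^ 2 - u ^ 2))
  rw [sub_self, zero_div] at h
  refine h.congr fun K ↦ ?_
  unfold linGPrim
  ring

/-- **Integral-test tail for the increments.** For `0 ≤ u ≤ t ≤ v ≤ l_M` and any finite family
`b_m ≤ f_{l_m}(t) − f_{l_m}(u)` (`m < M`):
`Σ_{m<M} b_m + (t² − u²)/(2(l_M² + v²)) ≤ Re ψ(1/4 + it/2) − Re ψ(1/4 + iu/2)`
(the increments dominate `(t²−u²)·2l_m/((l_m²+u²)(l_m²+v²))`, whose tail `m ≥ M` is at least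
`∫_M^∞ = log((l_M²+v²)/(l_M²+u²))/(2(v²−u²)) ≥ 1/(2(l_M²+v²))` by the integral test). [cite: Yoshida1992, §6 (series); integral test folklore] -/
theorem reDigammaQuarter_sub_ge_sum_add_tail {u t v : ℝ} (hu : 0 ≤ u) (hut : u ≤ t)
    (htv : t ≤ v) (M : ℕ) (hvM : v ≤ digammaNode M) {b : ℕ → ℝ}
    (hb : ∀ m < M, b m ≤ digammaTerm (digammaNode m) t - digammaTerm (digammaNode m) u) :
    ∑ m ∈ Finset.range M, b m + (t ^ 2 - u ^ 2) / (2 * (digammaNode M ^ 2 + v ^ 2)) ≤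
      reDigammaQuarter t - reDigammaQuarter u := by
  have ht0 : 0 ≤ t := hu.trans hut
  have hs0 : 0 ≤ t ^ 2 - u ^ 2 := by nlinarith
  set d : ℕ → ℝ := fun m ↦ digammaTerm (digammaNode m) t - digammaTerm (digammaNode m) u with hd
  have habs : |u| ≤ |t| := by rw [abs_of_nonneg hu, abs_of_nonneg ht0]; exact hut
  have hdn : ∀ m, 0 ≤ d m := fun m ↦ sub_nonneg.2 (digammaTerm_mono (digammaNode_pos m) habs)
  have hD : HasSum d (reDigammaQuarter t - reDigammaQuarter u) := by
    have h := (hasSum_digammaTerm t).sub (hasSum_digammaTerm u)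
    have e : reDigammaQuarter t - reDigammaQuarter u =
        reDigammaQuarter t - reDigammaQuarter 0 - (reDigammaQuarter u - reDigammaQuarter 0) := by ring
    rw [e]
    exact h
  have hbM : ∑ m ∈ Finset.range M, b m ≤ ∑ m ∈ Finset.range M, d m :=
    Finset.sum_le_sum fun m hm ↦ hb m (Finset.mem_range.1 hm)
  -- degenerate case `t = u`: no tail needed
  rcases eq_or_lt_of_le hs0 with hs | hs
  · rw [← hs, zero_div, add_zero]
    exact hbM.trans (sum_le_hasSum _ (fun m _ ↦ hdn m) hD)
  have huv2 : u ^ 2 < v ^ 2 := by nlinarith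
  set lin : ℕ → ℝ := fun m ↦ 2 * digammaNode m /
    ((digammaNode m ^ 2 + u ^ 2) * (digammaNode m ^ 2 + v ^ 2)) with hlin
  have hdlin : ∀ m, (t ^ 2 - u ^ 2) * lin m ≤ d m := by
    intro m
    have h := digammaTerm_sub_ge_lin (digammaNode_pos m) hu hut htv
    rw [hlin, hd]
    simp only
    rw [show (t ^ 2 - u ^ 2) * (2 * digammaNode m / ((digammaNode m ^ 2 + u ^ 2) * (digammaNode m ^ 2 + v ^ 2))) =
      2 * digammaNode m * (t ^ 2 - u ^ 2) / ((digammaNode m ^ 2 + u ^ 2) * (digammaNode m ^ 2 + v ^ 2)) by ring]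
    exact h
  have hM : (0 : ℝ) ≤ M := Nat.cast_nonneg M
  have hlinG : ∀ i : ℕ, lin (M + i) = linG u v ((M : ℝ) + i) := by
    intro i; rw [hlin]; simp only [linG, digammaNode]; push_cast; ring_nf
  -- partial sums
  have hpart : ∀ K : ℕ, ∑ m ∈ Finset.range M, b m +
      (t ^ 2 - u ^ 2) * (linGPrim u v ((M : ℝ) + K) - linGPrim u v M) ≤
        reDigammaQuarter t - reDigammaQuarter u := by
    intro K
    have h1 : ∑ m ∈ Finset.range (M + K), d m ≤ reDigammaQuarter t - reDigammaQuarter u :=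
      sum_le_hasSum _ (fun m _ ↦ hdn m) hD
    rw [Finset.sum_range_add] at h1
    have hanti : AntitoneOn (linG u v) (Icc (M : ℝ) ((M : ℝ) + K)) := by
      intro x hx y _ hxy
      refine linG_antitone hu (hut.trans htv) (hM.trans hx.1) (hvM.trans ?_) hxy
      simp only [digammaNode]; linarith [hx.1]
    have h3 := hanti.integral_le_sum
    rw [integral_linG huv2] at h3
    have h4 : ∑ i ∈ Finset.range K, linG u v ((M : ℝ) + i) = ∑ i ∈ Finset.range K, lin (M + i) :=
      Finset.sum_congr rfl fun i _ ↦ (hlinG i).symm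
    rw [h4] at h3
    have h5 : (t ^ 2 - u ^ 2) * (linGPrim u v ((M : ℝ) + K) - linGPrim u v M) ≤
        ∑ i ∈ Finset.range K, d (M + i) := by
      refine (mul_le_mul_of_nonneg_left h3 hs0).trans ?_
      rw [Finset.mul_sum]; exact Finset.sum_le_sum fun i _ ↦ hdlin (M + i)
    linarith
  have hlim : Tendsto (fun K : ℕ ↦ ∑ m ∈ Finset.range M, b m +
      (t ^ 2 - u ^ 2) * (linGPrim u v ((M : ℝ) + K) - linGPrim u v M)) atTop
      (𝓝 (∑ m ∈ Finset.range M, b m + (t ^ 2 - u ^ 2) * (0 - linGPrim u v M))) :=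
    tendsto_const_nhds.add (((tendsto_linGPrim u v M).sub tendsto_const_nhds).const_mul _)
  have hle := le_of_tendsto' hlim hpart
  -- the value of `−linGPrim(M)` dominates `1/(2(l_M² + v²))`
  have hval : 1 / (2 * (digammaNode M ^ 2 + v ^ 2)) ≤ 0 - linGPrim u v M := by
    unfold linGPrim
    simp only [digammaNode]
    have hy : 0 < ((2 * (M : ℝ) + 1 / 2) ^ 2 + v ^ 2) / ((2 * (M : ℝ) + 1 / 2) ^ 2 + u ^ 2) := by
      positivity
    have hlog := Real.one_sub_inv_le_log_of_pos hy
    rw [Real.log_div (by positivity) (by positivity), inv_div] at hlog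
    have hd2 : 0 < 2 * (v ^ 2 - u ^ 2) := by linarith
    have e1 : 1 - ((2 * (M : ℝ) + 1 / 2) ^ 2 + u ^ 2) / ((2 * (M : ℝ) + 1 / 2) ^ 2 + v ^ 2) =
        (v ^ 2 - u ^ 2) / ((2 * (M : ℝ) + 1 / 2) ^ 2 + v ^ 2) := by
      field_simp; ring
    rw [e1] at hlog
    have hB' : 0 < (2 * (M : ℝ) + 1 / 2) ^ 2 + v ^ 2 := by positivity
    rw [zero_sub, neg_div', neg_sub, le_div_iff₀ hd2]
    calc 1 / (2 * ((2 * (M : ℝ) + 1 / 2) ^ 2 + v ^ 2)) * (2 * (v ^ 2 - u ^ 2))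
        = (v ^ 2 - u ^ 2) / ((2 * (M : ℝ) + 1 / 2) ^ 2 + v ^ 2) := by field_simp
      _ ≤ _ := hlog
  have e : (t ^ 2 - u ^ 2) / (2 * (digammaNode M ^ 2 + v ^ 2)) =
      (t ^ 2 - u ^ 2) * (1 / (2 * (digammaNode M ^ 2 + v ^ 2))) := by ring
  rw [e]
  nlinarith [mul_le_mul_of_nonneg_left hval hs0]

/-- **Linear cells with tail.** For `0 ≤ u ≤ t ≤ v ≤ l_M`,
`(t² − u²) · (Σ_{m<M} 2l_m/((l_m²+u²)(l_m²+v²)) + 1/(2(l_M² + v²))) ≤ Re ψ(1/4+it/2) − Re ψ(1/4+iu/2)`. [folklore] -/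
theorem reDigammaQuarter_sub_ge_sum_lin_add_tail {u t v : ℝ} (hu : 0 ≤ u) (hut : u ≤ t)
    (htv : t ≤ v) (M : ℕ) (hvM : v ≤ digammaNode M) :
    (t ^ 2 - u ^ 2) * (∑ m ∈ Finset.range M, 2 * digammaNode m /
        ((digammaNode m ^ 2 + u ^ 2) * (digammaNode m ^ 2 + v ^ 2)) +
        1 / (2 * (digammaNode M ^ 2 + v ^ 2))) ≤
      reDigammaQuarter t - reDigammaQuarter u := by
  have h := reDigammaQuarter_sub_ge_sum_add_tail hu hut htv M hvM
    (b := fun m ↦ 2 * digammaNode m * (t ^ 2 - u ^ 2) /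
      ((digammaNode m ^ 2 + u ^ 2) * (digammaNode m ^ 2 + v ^ 2)))
    fun m _ ↦ digammaTerm_sub_ge_lin (digammaNode_pos m) hu hut htv
  have e : (t ^ 2 - u ^ 2) * (∑ m ∈ Finset.range M, 2 * digammaNode m /
        ((digammaNode m ^ 2 + u ^ 2) * (digammaNode m ^ 2 + v ^ 2)) +
        1 / (2 * (digammaNode M ^ 2 + v ^ 2))) =
      ∑ m ∈ Finset.range M, 2 * digammaNode m * (t ^ 2 - u ^ 2) /
        ((digammaNode m ^ 2 + u ^ 2) * (digammaNode m ^ 2 + v ^ 2)) +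
        (t ^ 2 - u ^ 2) / (2 * (digammaNode M ^ 2 + v ^ 2)) := by
    rw [mul_add, Finset.mul_sum]
    congr 1
    · exact Finset.sum_congr rfl fun m _ ↦ by ring
    · ring
  rw [e]
  exact h

/-- **Polynomial cells with tail.** For `0 ≤ u ≤ t ≤ v ≤ l_M` and any order `r`,
`Σ_{m<M} Σ_{k<2r} (−1)^k 2l_m (t²−u²)^{k+1}/(l_m²+u²)^{k+2} + (t²−u²)/(2(l_M²+v²)) ≤ Re ψ(1/4+it/2) − Re ψ(1/4+iu/2)`. [folklore] -/
theorem reDigammaQuarter_sub_ge_sum_poly_add_tail {u t v : ℝ} (hu : 0 ≤ u) (hut : u ≤ t)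
    (htv : t ≤ v) (M r : ℕ) (hvM : v ≤ digammaNode M) :
    ∑ m ∈ Finset.range M, ∑ k ∈ Finset.range (2 * r),
        (-1) ^ k * (2 * digammaNode m) * (t ^ 2 - u ^ 2) ^ (k + 1) /
          (digammaNode m ^ 2 + u ^ 2) ^ (k + 2) +
        (t ^ 2 - u ^ 2) / (2 * (digammaNode M ^ 2 + v ^ 2)) ≤
      reDigammaQuarter t - reDigammaQuarter u :=
  reDigammaQuarter_sub_ge_sum_add_tail hu hut htv M hvM fun m _ ↦
    digammaTerm_sub_ge_poly (digammaNode_pos m) (pow_le_pow_left₀ hu hut 2) r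

/-- The rational tail term `1/(2(l_M² + v²))` of the linear increments. [folklore] -/
def linTailLoQ (v : ℚ) (M : ℕ) : ℚ := 1 / (2 * (digammaNodeQ M * digammaNodeQ M + v * v))

/-- Cast of `linTailLoQ`. [folklore] -/
theorem linTailLoQ_cast (v : ℚ) (M : ℕ) :
    ((linTailLoQ v M : ℚ) : ℝ) = 1 / (2 * (digammaNode M ^ 2 + (v : ℝ) ^ 2)) := by
  unfold linTailLoQ; push_cast; rw [digammaNodeQ_cast]; ring

end Literature.NumberTheory.LFunctions
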